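import Summits.ABC.IUTFork.MLFGaloisTFG
import Literature.AnabelianGeometry.EtaleTheta.SettingModelChiZNAllSplittings
import Literature.AnabelianGeometry.EtaleTheta.Discharge.Sec1GJNTransport
import Literature.AnabelianGeometry.EtaleTheta.SettingModelTateZNAllSplittings
import Literature.AnabelianGeometry.EtaleTheta.Discharge.Sec1Thm16iiiOfOrigins
import Literature.AnabelianGeometry.EtaleTheta.SettingModelThm16iiiOriginInputsCensus
import Literature.AnabelianGeometry.EtaleTheta.SettingModelKrullZNAllSplittings
import Literature.AnabelianGeometry.EtaleTheta.Discharge.Sec1ZNUniquenessOfKummer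
import HarnessLib

/-!
# [EtTh] §1 `Z_N` chain: the strong-completeness / TFG input DISCHARGED (Summits-side assembly)

Cell `abc-iut` (run/shared/lean/pub/abc-iut/), layer L2, [EtTh] §1 p. 14 («`J_N := K_N(a^{1/N})_{a ∈ K_N}` … all
splittings determine the same splitting over `G_{J_N}` … `Π^tp_{Z_N}`») [cite: MochizukiEtTh2009, §1 p.14].
The Literature files of the `Z_N` chain carry ONE classical input BY NAME — strong completeness of `G_{ℚ_p}`
(«every finite-index subgroup is open», Nikolov–Segal at `G_k`), equivalently topological finite generation of
`G_{ℚ_p}` — because its unconditional proof (`Summit.ABC.IUTFork.isTopologicallyFinitelyGenerated_absoluteGaloisGroup_padic`,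
via Tate's local Euler–Poincaré characteristic proved Summits-side) cannot be imported Literature-side.  This file
plugs it in:

* `stronglyComplete_GQp` — every finite-index subgroup of `G_{ℚ_p}` is open, unconditionally;
* `gtpZNFromSplitting_modelχ_unconditional` — abc-iut-w5-d062's `SettingModel.gtpZNFromSplitting_modelχ` (p458978):
  the origin clause `GtpZNFromSplitting` holds at the χ-model for ALL lifted splittings and all `N`, NO hypothesis;
* `exists_isEtThOrigin_gtpZNFromSplitting_unconditional` — NV of the origin clause in the census shape;
* `haugJN_of_haugN_unconditional` — abc-iut-L2-t1's `Thm16Sub.haugJN_of_haugN` (p459263) with `hsc` discharged: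
  for any two theta settings and `γ` with (hΔ), `haugN ⇒ haugJN` at every level.

Proof-only assembly (no definition, no named fact, no `sorry`); seat abc-iut-w5-d062 (gen 4).  HONEST FRAMING:
classical inputs (Kummer theory, Nikolov–Segal at `G_{ℚ_p}`, Tate's Euler–Poincaré characteristic — all theorems of the
tree); the χ-model is SEMI-SYNTHETIC (consistency evidence only); nothing here asserts anything about abc or takes a
side on [IUTchIII] Cor. 3.12; typed ≠ proved for the nodes themselves.
-/

noncomputable section

namespace Summit.ABC.IUTFork

open Literature.AnabelianGeometry.EtaleTheta Literature.AnabelianGeometry.SemiGraphs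
open Literature.AnabelianGeometry.AbsoluteAnabelian Field

variable (p : ℕ) [Fact p.Prime]

/-- **`G_{ℚ_p}` is strongly complete, unconditionally**: every subgroup of finite index of `Gal(ℚ̄_p/ℚ_p)` is open
(Nikolov–Segal at `G_k`, tree `isOpen_of_finiteIndex_absoluteGaloisGroup`, fed with the Summits-side TFG theorem).
[cite: NikolovSegal2003, Thm 1.1] -/
theorem stronglyComplete_GQp : ∀ U : Subgroup (GQp p), U.FiniteIndex → IsOpen (U : Set (GQp p)) :=
  SettingModel.stronglyComplete_GQp_of_tfg p (isTopologicallyFinitelyGenerated_absoluteGaloisGroup_padic p ℚ_[p])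

/-- **The origin clause `GtpZNFromSplitting` HOLDS at the χ-model for ALL lifted splittings, unconditionally**
(abc-iut-w5-d062's p458978 with its TFG hypothesis discharged). [cite: MochizukiEtTh2009, §1 p.14] -/
theorem gtpZNFromSplitting_modelχ_unconditional (N : ℕ+) : (ThetaSetting.modelχ p).GtpZNFromSplitting N :=
  SettingModel.gtpZNFromSplitting_modelχ p (isTopologicallyFinitelyGenerated_absoluteGaloisGroup_padic p ℚ_[p]) N

/-- NV in the census shape: SOME theta setting of [EtTh] origin satisfies `GtpZNFromSplitting` at every level —
no hypothesis. [cite: MochizukiEtTh2009, §1 p.14] -/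
theorem exists_isEtThOrigin_gtpZNFromSplitting_unconditional :
    ∃ D : ThetaSetting p, D.IsEtThOrigin ∧ ∀ N, D.GtpZNFromSplitting N :=
  SettingModel.exists_isEtThOrigin_gtpZNFromSplitting p
    (isTopologicallyFinitelyGenerated_absoluteGaloisGroup_padic p ℚ_[p])

/-- **`haugJN ⟸ haugN + hΔ`, unconditionally** (abc-iut-L2-t1's `Thm16Sub.haugJN_of_haugN`, p459263, with the
strong-completeness hypothesis discharged): for any two theta settings `Dα`, `Dβ`, any `γ : Π^tp_{Xα} ≃ₜ* Π^tp_{Xβ}`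
carrying `Δ^tp_{Xα}` onto `Δ^tp_{Xβ}` and respecting the `G_{K_N}`-membership of the Galois images, `γ` respects the
`G_{J_N}`-membership. [cite: MochizukiEtTh2009, §1 p.14] -/
theorem haugJN_of_haugN_unconditional (Dα Dβ : ThetaSetting p) (γ : Dα.PiTemp ≃ₜ* Dβ.PiTemp)
    (hΔ : Dα.DeltaTemp.map γ.toMulEquiv.toMonoidHom = Dβ.DeltaTemp) (N : ℕ+)
    (haugN : ∀ g : Dα.PiTemp, Dβ.aug (γ.toMulEquiv g) ∈ Dβ.GKN N ↔ Dα.aug g ∈ Dα.GKN N) (g : Dα.PiTemp) :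
    Dβ.aug (γ.toMulEquiv g) ∈ Dβ.GJN N ↔ Dα.aug g ∈ Dα.GJN N :=
  Thm16Sub.haugJN_of_haugN Dα Dβ γ hΔ N haugN (stronglyComplete_GQp p) g

/-! ## Addendum (seat abc-iut-w5-d062 gen 5): the stage-2 («Tate shear») model and the K3 end-knit v5 with `hsc` discharged

abc-iut-L2-t1's stage-2 twin `SettingModelTateZNAllSplittings` (p463822: `GtpZNFromSplitting` for ALL lifted splittings at
`ThetaSetting.modelχq p i j hj`, modulo strong completeness of `G_{ℚ_p}`) and K3 end-knit v5 `Thm16Sub.thm16iii_of_origins`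
(p462527: [EtTh] Thm 1.6 (iii) at the origin predicates, carrying `hsc` verbatim = `stronglyComplete_GQp p`) with that ONE
classical input plugged in Summits-side.  Proof-only; nothing restated. -/

/-- **`GtpZNFromSplitting` HOLDS at the stage-2 model `modelχq p i j hj` for ALL lifted splittings, every level `N`, every
inner exponent `i` and every even shear exponent `j` — NO hypothesis** (abc-iut-L2-t1's
`SettingModel.gtpZNFromSplitting_modelχq_of_stronglyComplete`, p463822, fed with `stronglyComplete_GQp`).
[cite: MochizukiEtTh2009, §1 p.14] -/
theorem gtpZNFromSplitting_modelχq_unconditional (i j : ℤ) (hj : Even j) (N : ℕ+) :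
    (ThetaSetting.modelχq p i j hj).GtpZNFromSplitting N :=
  SettingModel.gtpZNFromSplitting_modelχq_of_stronglyComplete p i j hj N (stronglyComplete_GQp p)

/-- **Joint NV, unconditionally**: SOME theta setting is of [EtTh] origin, is a Tate origin AND satisfies the origin clause
`GtpZNFromSplitting` at every level (abc-iut-L2-t1's `SettingModel.exists_isEtThOrigin_isTateOrigin_gtpZNFromSplitting` with
`hsc` discharged; witness the stage-2 model `modelχq p 0 2`). [cite: MochizukiEtTh2009, §1 p.14] -/
theorem exists_isEtThOrigin_isTateOrigin_gtpZNFromSplitting_unconditional :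
    ∃ D : ThetaSetting p, D.IsEtThOrigin ∧ D.IsTateOrigin ∧ ∀ N, D.GtpZNFromSplitting N :=
  SettingModel.exists_isEtThOrigin_isTateOrigin_gtpZNFromSplitting p (stronglyComplete_GQp p)

/-- The same at EVERY inner exponent `i` of the Tate instance `(i, 2)` (abc-iut-w5-d051's `modelχq_isTateOrigin`,
abc-iut-L2-t5's `modelχq_isEtThOrigin`): `modelχq p i 2` is a joint witness of
`IsEtThOrigin ∧ IsTateOrigin ∧ ∀ N, GtpZNFromSplitting N`, no hypothesis. [cite: MochizukiEtTh2009, §1 p.14] -/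
theorem modelχq_isEtThOrigin_isTateOrigin_gtpZNFromSplitting (i : ℤ) :
    (ThetaSetting.modelχq p i 2 even_two).IsEtThOrigin ∧ (ThetaSetting.modelχq p i 2 even_two).IsTateOrigin ∧
      ∀ N, (ThetaSetting.modelχq p i 2 even_two).GtpZNFromSplitting N :=
  ⟨ThetaSetting.modelχq_isEtThOrigin p i 2 even_two, SettingModel.modelχq_isTateOrigin p i,
    gtpZNFromSplitting_modelχq_unconditional p i 2 even_two⟩

variable {p} in
/-- **[EtTh] Theorem 1.6 (iii) at the origin predicates with the strong-completeness input DISCHARGED** (abc-iut-L2-t1's K3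
end-knit v5 `Thm16Sub.thm16iii_of_origins`, p462527, with `hsc := stronglyComplete_GQp p`): every remaining hypothesis is an
origin predicate / origin clause of [EtTh] §1 (`IsThm16Origin`, `IsTateOrigin`, `GtpZNFromSplitting`, lifted splittings on
the `α` side), `hΔ` ([AbsAnab] Lem 1.3.8), `h65` ([SemiAnbd] Thm 6.5 (iii)), or a Prop 1.5 / valuation / inversion /
cusp-evaluation input displayed BY NAME — the «[by the definition of `J_N`]» step (p. 14) no longer carries a footnote.
[cite: MochizukiEtTh2009, Thm 1.6 (iii) p.25] -/
theorem thm16iii_of_origins_unconditional {Dα Dβ : ThetaSetting p} {γ : Dα.PiTemp ≃ₜ* Dβ.PiTemp}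
    (hα : Dα.IsThm16Origin) (hβ : Dβ.IsThm16Origin)
    (hTα : Dα.IsTateOrigin) (hTβ' : Dβ.IsTateOrigin)
    (h : ThetaSetting.Thm16i γ) (c : ThetaSetting.ThetaCompanion γ)
    (hΔ : Dα.DeltaTemp.map γ.toMulEquiv.toMonoidHom = Dβ.DeltaTemp)
    (h65 : Dα.IsoPreservesCuspidalDecomp Dβ.toTemperedCurve)
    (hzα : ∀ N, Dα.GtpZNFromSplitting N) (hsα : ∀ N : ℕ+, ∃ t, Dα.IsThetaSplittingAt N t)
    (hzβ : ∀ N, Dβ.GtpZNFromSplitting N)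
    (Eα : Dα.EtaleThetaData) (Eβ : Dβ.EtaleThetaData) (hCα : Dα.Compat) (hCβ : Dβ.Compat)
    (hSβ : Dβ.Sec2Hyps) (h15iiα : ThetaSetting.Prop15ii Eα.toKummerData hCα)
    (h15ii : ThetaSetting.Prop15ii Eβ.toKummerData hCβ)
    (h15α : ThetaSetting.Prop15iii Eα hCα) (h15β : ThetaSetting.Prop15iii Eβ hCβ)
    {σ : Dβ.PiTemp} (hσ : σ ∈ Dβ.GtpYdd)
    (Vα : ThetaSetting.ValuationHatData Dα Eα.toKummerData)
    (Vβ : ThetaSetting.ValuationHatData Dβ Eβ.toKummerData)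
    (hVα : Vα.unitsHat = Dα.unitsOKdd.map Eα.toKddHat) (hVβ : Vβ.unitsHat = Dβ.unitsOKdd.map Eβ.toKddHat)
    (h16ii : ThetaSetting.Thm16ii γ h Eα.toKummerData Eβ.toKummerData Vα Vβ)
    (hTβ : Dβ.HasThetaTopology) (hOβ : Dβ.IsEtThOrigin)
    {lamβ : ↥((Dβ.DtpYddN 1).map Dβ.toTheta) →ₜ* Dβ.DeltaTheta} (hstdβ : ThetaSetting.IsStdLog lamβ)
    (hresβ : ContH1.res (MonoidHom.id Dβ.GtpTheta) Dβ.DeltaTheta Dβ.map_toTheta_DtpYddN_one_le Eβ.logUdd =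
      ThetaSetting.homClass ThetaSetting.dtpYddTheta_le_deltaTheta_map lamβ)
    {ια : Dα.PiTemp ≃ₜ* Dα.PiTemp} (hια : Dα.IsInversionAut ια) (cα : ThetaSetting.ThetaCompanion ια)
    (hInvα : ThetaSetting.InvClauses Eα hια cα)
    (h15invβ : Dβ.Prop15iiiInvAnchored Eβ)
    (yβ : ThetaSetting.CuspidalPointDd Eβ.toKummerData) (hyβA : yβ.IsAnchored) (hyβ0 : yβ.IsOnLabelZero)
    (hyβfix : Dβ.FixesCuspBelow ((γ.symm.trans ια).trans γ) yβ)
    (y : ThetaSetting.CuspidalPointDd Eβ.toKummerData) {u₁ u₂ v₁ v₂ : (↥Dβ.Kdd)ˣ}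
    (hu₁ : u₁ ∈ Dβ.unitsOKdd) (hu₂ : u₂ ∈ Dβ.unitsOKdd)
    (hv : ‖((v₁ : Dβ.Kdd) : PadicAlgCl p)‖ = ‖((v₂ : Dβ.Kdd) : PadicAlgCl p)‖)
    (h₁ : haveI := hCβ.GtpYdd_normal
      y.evalAt (ContH1.res Dβ.toTheta Dβ.DeltaTheta (y.sec_le.trans y.Dpt_le)
        (ContH1.conj Dβ.toTheta Dβ.DeltaTheta σ Eβ.etaDd)) = Eβ.toKddHat (u₁ * v₁))
    (h₂ : y.evalAt (ContH1.res Dβ.toTheta Dβ.DeltaTheta (y.sec_le.trans y.Dpt_le)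
        (ThetaSetting.transport c h Eα.etaDd)) = Eβ.toKddHat (u₂ * v₂)) :
    ThetaSetting.Thm16iii γ h c Eα Eβ hCβ :=
  Thm16Sub.thm16iii_of_origins hα hβ hTα hTβ' h c hΔ h65 (stronglyComplete_GQp p) hzα hsα hzβ
    Eα Eβ hCα hCβ hSβ h15iiα h15ii h15α h15β hσ Vα Vβ hVα hVβ h16ii
    hTβ hOβ hstdβ hresβ hια cα hInvα h15invβ yβ hyβA hyβ0 hyβfix y hu₁ hu₂ hv h₁ h₂

/-! ## Addendum v3 (seat abc-iut-w5-d062 gen 5): abc-iut-L2-t1's K3 origin-inputs KERNEL CENSUS with `hsc` discharged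

abc-iut-L2-t1's `SettingModelThm16iiiOriginInputsCensus` (p466165) lists, at the two models of record, which setting-level
covering inputs of the K3 end-knit v5 hold JOINTLY — carrying strong completeness of `G_{ℚ_p}` as `hsc` for the `Z_N`
clause.  Plugging `stronglyComplete_GQp` makes both statements hypothesis-free Summits-side (abc-iut-L2-lead R634). -/

/-- **The setting-level covering inputs of the K3 end-knit v5 at the stage-2 model `modelχq p i 2`, NO hypothesis**
(abc-iut-L2-t1's `SettingModel.modelχq_thm16iiiOriginInputs`, p466165, with `hsc := stronglyComplete_GQp p`): guard,
`IsTateOrigin`, `HasThetaTopology`, R1, R2 ∀N, `GKNIsKernelOfAction` ∀N, `GtpZNFromSplitting` ∀N, lifted splittings ∀N —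
and NO cuspidal decomposition group, hence `¬ IsThm16Origin`. [cite: MochizukiEtTh2009, §1 p.13] -/
theorem modelχq_thm16iiiOriginInputs_unconditional (i : ℤ) :
    (ThetaSetting.modelχq p i 2 even_two).IsEtThOrigin ∧
      (ThetaSetting.modelχq p i 2 even_two).IsTateOrigin ∧
      (ThetaSetting.modelχq p i 2 even_two).HasThetaTopology ∧
      Thm16Sub.KerToZIsCompactlyGenerated (ThetaSetting.modelχq p i 2 even_two) ∧
      (∀ N : ℕ+, Thm16Sub.GtpYNFromCusp (ThetaSetting.modelχq p i 2 even_two) N) ∧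
      (∀ N : ℕ+, Thm16Sub.GKNIsKernelOfAction (ThetaSetting.modelχq p i 2 even_two) N) ∧
      (∀ N : ℕ+, (ThetaSetting.modelχq p i 2 even_two).GtpZNFromSplitting N) ∧
      (∀ N : ℕ+, ∃ t, (ThetaSetting.modelχq p i 2 even_two).IsThetaSplittingAt N t) ∧
      (∀ Dc : Subgroup (SettingModel.PiTpχq p i 2),
        ¬ (ThetaSetting.modelχq p i 2 even_two).IsCuspidalDecompositionGroup Dc) ∧
      ¬ (ThetaSetting.modelχq p i 2 even_two).IsThm16Origin :=
  SettingModel.modelχq_thm16iiiOriginInputs p i (stronglyComplete_GQp p)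

/-- **KERNEL CENSUS of the setting-level inputs of [EtTh] Thm 1.6 (iii) at the origin predicates, NO hypothesis**
(abc-iut-L2-t1's `SettingModel.thm16iii_originInputs_census`, p466165, with `hsc := stronglyComplete_GQp p`): the
`IsTateOrigin` side {guard, `IsTateOrigin`, `HasThetaTopology`, `GtpZNFromSplitting` ∀N, lifted splittings ∀N} is jointly
inhabited where `IsThm16Origin` fails; the `IsThm16Origin` side {guard, `IsThm16Origin`, `CuspLaws`, cusp section, lifted
splittings ∀N} is jointly inhabited where `IsTateOrigin` fails; and at each of `modelκ′`, `modelκ`, `modelχq p 0 2`,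
`modelχq′ p 0 2` the conjunction `IsThm16Origin ∧ IsTateOrigin` fails (abc-iut-L2-t10's zoo row) — the joint inhabitant is
the §1-interface residual of record (abc-iut-L2-lead R550). [cite: MochizukiEtTh2009, Thm 1.6 (iii) p.25] -/
theorem thm16iii_originInputs_census_unconditional :
    (∃ D : ThetaSetting p, D.IsEtThOrigin ∧ D.IsTateOrigin ∧ D.HasThetaTopology ∧
        (∀ N : ℕ+, D.GtpZNFromSplitting N) ∧ (∀ N : ℕ+, ∃ t, D.IsThetaSplittingAt N t) ∧ ¬ D.IsThm16Origin) ∧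
      (∃ D : ThetaSetting p, D.IsEtThOrigin ∧ D.IsThm16Origin ∧ D.CuspLaws ∧
        (∃ (Dc : Subgroup D.PiTemp) (s : GQp p →* D.PiTemp), D.IsCuspidalDecompositionGroup Dc ∧ Dc ≤ D.GtpY ∧
          (∀ g : GQp p, g ∈ D.GK → D.aug (s g) = g) ∧ D.GK.map s ≤ Dc) ∧
        (∀ N : ℕ+, ∃ t, D.IsThetaSplittingAt N t) ∧ ¬ D.IsTateOrigin) ∧
      (¬ ((ThetaSetting.modelκ' p).IsThm16Origin ∧ (ThetaSetting.modelκ' p).IsTateOrigin) ∧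
        ¬ ((ThetaSetting.modelκ p).IsThm16Origin ∧ (ThetaSetting.modelκ p).IsTateOrigin) ∧
        ¬ ((ThetaSetting.modelχq p 0 2 even_two).IsThm16Origin ∧ (ThetaSetting.modelχq p 0 2 even_two).IsTateOrigin) ∧
        ¬ ((ThetaSetting.modelχq' p 0 2 even_two).IsThm16Origin ∧
          (ThetaSetting.modelχq' p 0 2 even_two).IsTateOrigin)) :=
  SettingModel.thm16iii_originInputs_census p (stronglyComplete_GQp p)

/-! ## Addendum v4 (seat abc-iut-w5-d062 gen 5): the cusped KRULL model `modelκ′` — abc-iut-L2-t1's file B with `hsc` discharged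

abc-iut-L2-t1's `SettingModelKrullZNAllSplittings` (p467332): `GtpZNFromSplitting` for ALL lifted splittings at the tree's
`IsThm16Origin` inhabitant `ThetaSetting.modelκ' p` (trivial Galois action on `Γ`; the level character of a splitting kills
`G_{J_N}` by this seat's `apply_eq_one_of_mem_GJN_of_stronglyComplete`), modulo strong completeness of `G_{ℚ_p}`; plugged here. -/

/-- **`GtpZNFromSplitting` HOLDS at the cusped Krull model `modelκ′` for ALL lifted splittings and every level `N` — NO
hypothesis** (abc-iut-L2-t1's `SettingModel.gtpZNFromSplitting_modelκ'_of_stronglyComplete`, p467332, fed with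
`stronglyComplete_GQp`). [cite: MochizukiEtTh2009, §1 p.14] -/
theorem gtpZNFromSplitting_modelκ'_unconditional (N : ℕ+) : (ThetaSetting.modelκ' p).GtpZNFromSplitting N :=
  SettingModel.gtpZNFromSplitting_modelκ'_of_stronglyComplete p N (stronglyComplete_GQp p)

/-- **The `IsThm16Origin`-side of the K3 origin-inputs census at `modelκ′`, v2, NO hypothesis** (abc-iut-L2-t1's
`SettingModel.modelκ'_thm16iiiOriginInputs_v2`, p467332, with `hsc := stronglyComplete_GQp p`): guard ∧ `IsThm16Origin` ∧
`CuspLaws` ∧ `HasThetaTopology` ∧ a cusp SECTION package ∧ lifted splittings ∀N ∧ `GtpZNFromSplitting` ∀N ∧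
`GKNIsKernelOfAction 2` — and `¬ IsTateOrigin`. [cite: MochizukiEtTh2009, §1 p.14] -/
theorem modelκ'_thm16iiiOriginInputs_v2_unconditional :
    (ThetaSetting.modelκ' p).IsEtThOrigin ∧ (ThetaSetting.modelκ' p).IsThm16Origin ∧ (ThetaSetting.modelκ' p).CuspLaws ∧
      (ThetaSetting.modelκ' p).HasThetaTopology ∧
      (∃ (Dc : Subgroup (ThetaSetting.modelκ' p).PiTemp) (s : GQp p →* (ThetaSetting.modelκ' p).PiTemp),
        (ThetaSetting.modelκ' p).IsCuspidalDecompositionGroup Dc ∧ Dc ≤ (ThetaSetting.modelκ' p).GtpY ∧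
          (∀ g : GQp p, g ∈ (ThetaSetting.modelκ' p).GK → (ThetaSetting.modelκ' p).aug (s g) = g) ∧
          (ThetaSetting.modelκ' p).GK.map s ≤ Dc) ∧
      (∀ N : ℕ+, ∃ t, (ThetaSetting.modelκ' p).IsThetaSplittingAt N t) ∧
      (∀ N : ℕ+, (ThetaSetting.modelκ' p).GtpZNFromSplitting N) ∧
      Thm16Sub.GKNIsKernelOfAction (ThetaSetting.modelκ' p) 2 ∧
      ¬ (ThetaSetting.modelκ' p).IsTateOrigin :=
  SettingModel.modelκ'_thm16iiiOriginInputs_v2 p (stronglyComplete_GQp p)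

/-- **Joint NV `IsThm16Origin ∧ GtpZNFromSplitting ∀N`, NO hypothesis** (abc-iut-L2-t1's
`SettingModel.exists_isThm16Origin_gtpZNFromSplitting`, p467332, with `hsc` discharged; witness `modelκ′`): SOME theta setting of
[EtTh] origin satisfies `IsThm16Origin`, the cusp laws, `HasThetaTopology`, carries a Galois section into a cuspidal
decomposition group inside `Π^tp_Y`, has lifted splittings and `GtpZNFromSplitting` at every level, and is NOT a Tate origin.
[cite: MochizukiEtTh2009, §1 p.14] -/
theorem exists_isThm16Origin_gtpZNFromSplitting_unconditional :
    ∃ D : ThetaSetting p, D.IsEtThOrigin ∧ D.IsThm16Origin ∧ D.CuspLaws ∧ D.HasThetaTopology ∧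
      (∃ (Dc : Subgroup D.PiTemp) (s : GQp p →* D.PiTemp), D.IsCuspidalDecompositionGroup Dc ∧ Dc ≤ D.GtpY ∧
        (∀ g : GQp p, g ∈ D.GK → D.aug (s g) = g) ∧ D.GK.map s ≤ Dc) ∧
      (∀ N : ℕ+, ∃ t, D.IsThetaSplittingAt N t) ∧ (∀ N : ℕ+, D.GtpZNFromSplitting N) ∧ ¬ D.IsTateOrigin :=
  SettingModel.exists_isThm16Origin_gtpZNFromSplitting p (stronglyComplete_GQp p)

/-! ## Addendum v5 (seat abc-iut-w5-d062 gen 5): the ROOT-LEVEL uniqueness theorem with `hsc` discharged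

This seat's `Discharge/Sec1ZNUniquenessOfKummer` (p470538) proves print's «[by the definition of `J_N`] all splittings determine
the same splitting over `G_{J_N}`» for an ARBITRARY theta setting, from the ∃-form of the origin clause, the printed structure
`hcen` («`Π^tp_{Y_N}` centralises `(Δ^tp_{Y_N})^Θ` modulo `N·(Δ^tp_Y)^Θ`») and strong completeness of `G_{ℚ_p}`; here the
last input is plugged in, so the ∀-form of `GtpZNFromSplitting` becomes a theorem of {∃-form, `hcen`} at print generality. -/

variable {p} in
/-- **[EtTh] §1 p. 14 at print generality, Summits-side**: for EVERY theta setting `D` and level `N`, if `Π^tp_{Y_N}`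
centralises `(Δ^tp_{Y_N})^Θ` modulo `N·(Δ^tp_Y)^Θ` (`hcen`) and SOME lifted splitting over `G_{K_N}` cuts out `Π^tp_{Z_N}`
(`hex`, print's definition of `Z_N`), then EVERY lifted splitting does — `D.GtpZNFromSplitting N` — with NO classical
hypothesis left (this seat's `ThetaSetting.gtpZNFromSplitting_of_exists_of_stronglyComplete`, p470538, fed with
`stronglyComplete_GQp`). [cite: MochizukiEtTh2009, §1 p.14] -/
theorem gtpZNFromSplitting_of_exists_unconditional (D : ThetaSetting p) (N : ℕ+)
    (hcen : ∀ g ∈ D.GtpYN N, ∀ y ∈ D.DtpYN N,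
      D.toTheta g * D.toTheta y * (D.toTheta g)⁻¹ * (D.toTheta y)⁻¹ ∈ D.thetaPowersY N)
    (hex : ∃ s₀ : ↥(D.GKN N) → D.GtpTheta, D.IsThetaSplittingAt N s₀ ∧
      ∀ g : D.PiTemp, g ∈ D.GtpZN N ↔ g ∈ D.GtpYN N ∧ ∃ h : D.aug g ∈ D.GJN N,
        D.toTheta g * (s₀ ⟨D.aug g, D.GJN_le_GKN N h⟩)⁻¹ ∈ D.thetaPowersY N) :
    D.GtpZNFromSplitting N :=
  D.gtpZNFromSplitting_of_exists_of_stronglyComplete (stronglyComplete_GQp p) hcen hex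

variable {p} in
/-- **Any two lifted splittings agree on `G_{J_N}` modulo `N·(Δ^tp_Y)^Θ`, unconditionally in the classical input**
(this seat's `ThetaSetting.splittings_agree_of_exists_of_stronglyComplete` with `hsc := stronglyComplete_GQp p`).
[cite: MochizukiEtTh2009, §1 p.14] -/
theorem splittings_agree_of_exists_unconditional (D : ThetaSetting p) (N : ℕ+)
    (hcen : ∀ g ∈ D.GtpYN N, ∀ y ∈ D.DtpYN N,
      D.toTheta g * D.toTheta y * (D.toTheta g)⁻¹ * (D.toTheta y)⁻¹ ∈ D.thetaPowersY N)
    (hex : ∃ s₀ : ↥(D.GKN N) → D.GtpTheta, D.IsThetaSplittingAt N s₀ ∧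
      ∀ g : D.PiTemp, g ∈ D.GtpZN N ↔ g ∈ D.GtpYN N ∧ ∃ h : D.aug g ∈ D.GJN N,
        D.toTheta g * (s₀ ⟨D.aug g, D.GJN_le_GKN N h⟩)⁻¹ ∈ D.thetaPowersY N)
    {s s' : ↥(D.GKN N) → D.GtpTheta} (hs : D.IsThetaSplittingAt N s) (hs' : D.IsThetaSplittingAt N s')
    {σ : GQp p} (hσ : σ ∈ D.GJN N) :
    s ⟨σ, D.GJN_le_GKN N hσ⟩ * (s' ⟨σ, D.GJN_le_GKN N hσ⟩)⁻¹ ∈ D.thetaPowersY N :=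
  D.splittings_agree_of_exists_of_stronglyComplete (stronglyComplete_GQp p) hcen hex hs hs' hσ

/-! ## Addendum v6 (seat abc-iut-w5-d062 gen 5): abc-iut-L2-t1's K3 END-KNIT v6 with `hsc` discharged

abc-iut-L2-t1's `Thm16Sub.thm16iii_of_origins_of_znDef` (p471699) is [EtTh] Thm 1.6 (iii) at the origin predicates with the
origin clause `GtpZNFromSplitting` replaced, on each side, by print's DEFINITION of `Z_N` (the ∃-form) and the centrality clause
`hcen` — through this seat's root uniqueness theorem (p470538) — still carrying `hsc`.  Plugging `stronglyComplete_GQp`: -/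

variable {p} in
/-- **[EtTh] Theorem 1.6 (iii) at the origin predicates, K3 end-knit v6, with the strong-completeness input DISCHARGED**
(abc-iut-L2-t1's `Thm16Sub.thm16iii_of_origins_of_znDef`, p471699, with `hsc := stronglyComplete_GQp p`): the remaining
hypotheses are the origin predicates `IsThm16Origin`/`IsTateOrigin` on both sides, `hΔ` ([AbsAnab] Lem 1.3.8), `h65` ([SemiAnbd]
Thm 6.5 (iii)), per side the two DISPLAYED printed clauses of p. 14 (the ∃-form definition of `Z_N`, the centrality clause
`hcen`), and the Prop 1.5 / valuation / inversion / cusp-evaluation inputs verbatim — NO classical hypothesis.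
[cite: MochizukiEtTh2009, Thm 1.6 (iii) p.25] -/
theorem thm16iii_of_origins_of_znDef_unconditional {Dα Dβ : ThetaSetting p} {γ : Dα.PiTemp ≃ₜ* Dβ.PiTemp}
    (hα : Dα.IsThm16Origin) (hβ : Dβ.IsThm16Origin)
    (hTα : Dα.IsTateOrigin) (hTβ' : Dβ.IsTateOrigin)
    (h : ThetaSetting.Thm16i γ) (c : ThetaSetting.ThetaCompanion γ)
    (hΔ : Dα.DeltaTemp.map γ.toMulEquiv.toMonoidHom = Dβ.DeltaTemp)
    (h65 : Dα.IsoPreservesCuspidalDecomp Dβ.toTemperedCurve)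
    (hcenα : ∀ N : ℕ+, ∀ g ∈ Dα.GtpYN N, ∀ y' ∈ Dα.DtpYN N,
      Dα.toTheta g * Dα.toTheta y' * (Dα.toTheta g)⁻¹ * (Dα.toTheta y')⁻¹ ∈ Dα.thetaPowersY N)
    (hexα : ∀ N : ℕ+, ∃ s₀ : ↥(Dα.GKN N) → Dα.GtpTheta, Dα.IsThetaSplittingAt N s₀ ∧
      ∀ g : Dα.PiTemp, g ∈ Dα.GtpZN N ↔ g ∈ Dα.GtpYN N ∧ ∃ h' : Dα.aug g ∈ Dα.GJN N,
        Dα.toTheta g * (s₀ ⟨Dα.aug g, Dα.GJN_le_GKN N h'⟩)⁻¹ ∈ Dα.thetaPowersY N)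
    (hcenβ : ∀ N : ℕ+, ∀ g ∈ Dβ.GtpYN N, ∀ y' ∈ Dβ.DtpYN N,
      Dβ.toTheta g * Dβ.toTheta y' * (Dβ.toTheta g)⁻¹ * (Dβ.toTheta y')⁻¹ ∈ Dβ.thetaPowersY N)
    (hexβ : ∀ N : ℕ+, ∃ s₀ : ↥(Dβ.GKN N) → Dβ.GtpTheta, Dβ.IsThetaSplittingAt N s₀ ∧
      ∀ g : Dβ.PiTemp, g ∈ Dβ.GtpZN N ↔ g ∈ Dβ.GtpYN N ∧ ∃ h' : Dβ.aug g ∈ Dβ.GJN N,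
        Dβ.toTheta g * (s₀ ⟨Dβ.aug g, Dβ.GJN_le_GKN N h'⟩)⁻¹ ∈ Dβ.thetaPowersY N)
    (Eα : Dα.EtaleThetaData) (Eβ : Dβ.EtaleThetaData) (hCα : Dα.Compat) (hCβ : Dβ.Compat)
    (hSβ : Dβ.Sec2Hyps) (h15iiα : ThetaSetting.Prop15ii Eα.toKummerData hCα)
    (h15ii : ThetaSetting.Prop15ii Eβ.toKummerData hCβ)
    (h15α : ThetaSetting.Prop15iii Eα hCα) (h15β : ThetaSetting.Prop15iii Eβ hCβ)
    {σ : Dβ.PiTemp} (hσ : σ ∈ Dβ.GtpYdd)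
    (Vα : ThetaSetting.ValuationHatData Dα Eα.toKummerData)
    (Vβ : ThetaSetting.ValuationHatData Dβ Eβ.toKummerData)
    (hVα : Vα.unitsHat = Dα.unitsOKdd.map Eα.toKddHat) (hVβ : Vβ.unitsHat = Dβ.unitsOKdd.map Eβ.toKddHat)
    (h16ii : ThetaSetting.Thm16ii γ h Eα.toKummerData Eβ.toKummerData Vα Vβ)
    (hTβ : Dβ.HasThetaTopology) (hOβ : Dβ.IsEtThOrigin)
    {lamβ : ↥((Dβ.DtpYddN 1).map Dβ.toTheta) →ₜ* Dβ.DeltaTheta} (hstdβ : ThetaSetting.IsStdLog lamβ)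
    (hresβ : ContH1.res (MonoidHom.id Dβ.GtpTheta) Dβ.DeltaTheta Dβ.map_toTheta_DtpYddN_one_le Eβ.logUdd =
      ThetaSetting.homClass ThetaSetting.dtpYddTheta_le_deltaTheta_map lamβ)
    {ια : Dα.PiTemp ≃ₜ* Dα.PiTemp} (hια : Dα.IsInversionAut ια) (cα : ThetaSetting.ThetaCompanion ια)
    (hInvα : ThetaSetting.InvClauses Eα hια cα)
    (h15invβ : Dβ.Prop15iiiInvAnchored Eβ)
    (yβ : ThetaSetting.CuspidalPointDd Eβ.toKummerData) (hyβA : yβ.IsAnchored) (hyβ0 : yβ.IsOnLabelZero)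
    (hyβfix : Dβ.FixesCuspBelow ((γ.symm.trans ια).trans γ) yβ)
    (y : ThetaSetting.CuspidalPointDd Eβ.toKummerData) {u₁ u₂ v₁ v₂ : (↥Dβ.Kdd)ˣ}
    (hu₁ : u₁ ∈ Dβ.unitsOKdd) (hu₂ : u₂ ∈ Dβ.unitsOKdd)
    (hv : ‖((v₁ : Dβ.Kdd) : PadicAlgCl p)‖ = ‖((v₂ : Dβ.Kdd) : PadicAlgCl p)‖)
    (h₁ : haveI := hCβ.GtpYdd_normal
      y.evalAt (ContH1.res Dβ.toTheta Dβ.DeltaTheta (y.sec_le.trans y.Dpt_le)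
        (ContH1.conj Dβ.toTheta Dβ.DeltaTheta σ Eβ.etaDd)) = Eβ.toKddHat (u₁ * v₁))
    (h₂ : y.evalAt (ContH1.res Dβ.toTheta Dβ.DeltaTheta (y.sec_le.trans y.Dpt_le)
        (ThetaSetting.transport c h Eα.etaDd)) = Eβ.toKddHat (u₂ * v₂)) :
    ThetaSetting.Thm16iii γ h c Eα Eβ hCβ :=
  Thm16Sub.thm16iii_of_origins_of_znDef hα hβ hTα hTβ' h c hΔ h65 (stronglyComplete_GQp p) hcenα hexα hcenβ hexβ
    Eα Eβ hCα hCβ hSβ h15iiα h15ii h15α h15β hσ Vα Vβ hVα hVβ h16ii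
    hTβ hOβ hstdβ hresβ hια cα hInvα h15invβ yβ hyβA hyβ0 hyβfix y hu₁ hu₂ hv h₁ h₂

end Summit.ABC.IUTFork

end
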